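import Literature.MathematicalPhysics.QuantumFieldTheory.Balaban1983to89.B8Thm2TorusPeriodic
import Literature.MathematicalPhysics.QuantumFieldTheory.Balaban1983to89.B8Thm2TorusPointwise

/-!
# `Balaban1983to89.B8Thm2TorusAtSupplier` — [Balaban1985RegularSpaces] THEOREM 2 (p. 83) FOR THE DOMAIN SEQUENCE `Ω_j = T_η`: THE EXISTENCE HALF OF
# THE INTERFACE OF RECORD `B8Thm2TorusAt` (`Concl2T`: a `P`-periodic unitary-valued restricted `u` and a `P`-periodic self-adjoint `A` with
# `U′^{u⁻¹} = e^{iηA}`, (1.36) `C136T`, (1.37) `C137T`, (1.38) `IsLandau138`, (1.39) `C139T`) AT EVERY TORUS MEMBER, `G = unitaryUnits`, torus side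
# `P = Lᵏ·N`, Hölder datum `β₀ = 0` — SUPPLIED modulo the four sockets of the `ℤᵈ` knit at torus members (sub-row «G-B8-T2S», module M4-final of
# `lit-balaban-p33/T2S-MAP.md`; the first SUPPLIER of an interface that so far had consumers only)

statement-level skeleton of published theorems with citation tags; proofs where landed; nothing here is a claim about the
Yang–Mills mass gap

T. Bałaban, *Spaces of regular gauge field configurations on a lattice and gauge fixing conditions*, Commun. Math. Phys. **99** (1985) 75–102
`[Balaban1985RegularSpaces]`: Theorem 2 p. 83, (1.33)–(1.39) pp. 82–83, (1.29) p. 81, p. 77 («we admit the case where some domains Ω_j are equal to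
T_η»), Theorem 4 p. 88 («Of course this theorem implies Theorem 2»).  STATUS: published, refereed.

CITATION HEADER (lean-in-tree rule).  Cell `lit-balaban`, seat `lit-balaban-p33` (gen 90), sub-row «G-B8-T2S» = [B8] §3 THEOREM 2 TORUS SUPPLIER for
R3 `stmt-QuantumFields-19200` (ym3 ★★OWNER WANTED W-19200-T2: the LIGHTER SUFFICIENT TARGET «existence half, β₀ B₂ len per member»).  WHAT IS
REPRODUCED: the assembly of this seat's modules M2 (`B8Thm2TorusMember`: the torus members of the knit family and Theorem 2 at them), M1
(`B8TorusShiftStencils`∕`Averaging`∕`Landau`, `B8Thm2TorusPeriodic`: periodic data ⇒ periodic `u`), M4 (`B8Thm2TorusBridge`, `B8Thm2TorusPointwise`: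
the interface's letters, pointwise strict members) into **`thm2TorusAt_exists_of_socketsE`**: for `d, L ≥ 2` and the knit's providers there are
`B₁, B₂, c₁ > 0` such that AT EVERY TORUS MEMBER (`η > 0`, `k ≥ 1`) and every torus side `P = Lᵏ·N`, for `α₀, α₁ > 0`, `α₀ + α₁ ≤ c₁`, unitary-valued
`P`-periodic `U₀`, `U′` with (1.33) `InAk … {T_η} U₀`, (1.34) `InAk … {T_η} (U′U₀) ∧ InAx L k (torusLam k) U₀ (U′U₀)`, (1.35) `Hyp135 L k (torusLam k) α₁
U₀ U′`: THERE IS a unitary-valued `P`-PERIODIC `u` with (1.29) `Restr129 L k (torusLam k) U₀ u` and `B8Thm2TorusAt.Concl2T L k P η 0 B₁ B₂ len α₀ α₁ U₀ U′ u`.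
Kind: theorems only; no `def`, no `… : Prop` fact; no existing module modified.

## HONEST SCOPE — what is NOT claimed (read before consuming)
(i) **Modulo the four knit sockets AT TORUS MEMBERS** (`SockHFP₀`∕`SockHFP` = Proposition 5's fixed points, `SockP5uE` = its uniqueness, `SockB9P3` at every
truncation = the in-edge [4] Thm 3.3 in Proposition 3's frame): at a GENERAL regular background these are [Balaban1985BackgroundPropagators] Thms
3.1–3.3 for that background, which the tree has at letters ∕ at `U = 1` only — the XL residual of the sub-row (`T2S-MAP.md` M5…).  (ii) **Hölder datum
`β₀ = 0`**: the (1.36)₃ clause of `C136T` is delivered at `β = 0` ONLY, where the quotient (3.40) is the plain oscillation `‖U(Γ)F(x′) − F(x)‖` (bounded by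
two gradient bounds, transport unitary); the genuine `β`-Hölder bound is in the tree in the knit's weighted-norm currency
(`B8Thm2TorusBridge.thm2T_core_of_socketsE`), its pointwise reading needs a lower bound on `len` (not attempted).  (iii) **Existence half only**: the
uniqueness clause of `Thm2TorusAt` («exactly one» among periodic restricted `u′` with `Concl2T` AT THESE CONSTANTS) is NOT delivered — the knit's
uniqueness (used inside for the periodicity) is keyed to its own smallness letter `α₀ + (11d²α₀ + α₁)`, the interface's to `(1 + 11d²)(α₀ + α₁)`.
(iv) `G = unitaryUnits 𝔸` (the `SU(N)` instance `B8Thm2SetupTorus.thm2SetupAt_specialUnitary_of_thm2TorusAt` needs `G = specialUnitaryUnits`: joint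
J-SU, open); `Reg` unused (the torus has no (3.35) boundary regularity to check); `P = Lᵏ·N` (the consumers' `P = N·Lᵏ`).  (v) `d ≥ 2`, `L ≥ 2`, `𝔸` a
C⋆-algebra.  Count-neutral; N05 not discharged; nothing continuum ∕ ℝ⁴ ∕ OS ∕ mass-gap ∕ Clay.
-/

noncomputable section

open NormedSpace
open scoped BigOperators

namespace Literature.MathematicalPhysics.QuantumFieldTheory.Balaban1983to89.B8Thm2TorusAtSupplier

open B7Prop1Explicit (e U1 hol_mem)
open B7Prop2Explicit (unitaryUnits unitaryUnits_le_U1)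
open B7Eq92Concrete (mgauge)
open B8Ineq132 (InAk BondTouches covDerivFwd)
open B8Eq119TwistedAxial (Restr129 InAx)
open B8Lemma1NonAbelian (mulCfg)
open B8Eq140Level (SideTouches)
open B8Eq184Proof (cfgExp)
open B8Eq146AExpansion (iEta plaqCovDeriv)
open B8Eq143PlaqExpansion (pdiv)
open B7Prop4GeneralLevels (logCovIter)
open B8Eq138LandauZd (IsLandau138 IsLandau138W logCfg covLap)
open B9Eq340HolderZd (hquot AdmPair norm_trans)
open B8Eq155JBound (norm_covDerivFwd_le_of_141)
open B8ScaledSupNorm (msup bondNorm weight Bdd bdd_of_forall weight_neg_natCast scale_pos)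
open B8Thm4TorusAt (torusLam)
open B8Thm2TorusAt (Cond135T C136T C137T C139T Concl2T hyp135_torusLam_iff)
open B8Eq133Hypotheses (Hyp135)
open B8LeafModelZdSockP5uE (SockP5uE)
open B8LeafModelZdOfHFP (SockHFP₀ SockHFP)
open B8LeafModelZd3 (zdGF3 SockB9P3 mlogCfg)
open B12Ineq417Flat (shiftCfg shiftCfg_apply)
open B7TranslationCovariance (mgauge_shiftCfg)
open B8Thm2TorusMember (TorusMember torusIdx torusLamb mem_torusLamb_iff)
open B8Thm2TorusBridge (h135_of_cond135T inAx_torusLam_of_top mlogCfg_univ)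
open B8Thm2TorusPeriodic (thm2_torus_periodic_of_socketsE)
open B8Thm2TorusPointwise (norm_pdiv_le_of_forall norm_covLap_le_of_forall le_of_weight_mul_le)

-- the `ℤ^d` sites of `B7Prop1Explicit` are `LSite` here (convention of `B8Thm2TorusAt`).
open B7Prop1Explicit renaming Site → LSite

variable {d : ℕ}

section Supplier

variable {𝔸 : Type} [CStarAlgebra 𝔸] [Nontrivial 𝔸]

omit [CStarAlgebra 𝔸] [Nontrivial 𝔸] in
/-- At `Ω = ℤᵈ` every bond is a side of a plaquette touching `Ω` (`d ≥ 2`). [cite: Balaban1985RegularSpaces, p.77 (plaquette ∕ bond conventions)] -/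
private theorem sideTouches_univ₄ (hd2 : 2 ≤ d) (y : LSite d) (τ : Fin d) : SideTouches (Set.univ : Set (LSite d)) y τ := by
  haveI : Nontrivial (Fin d) := Fin.nontrivial_iff_two_le.mpr hd2
  obtain ⟨κ, hκ⟩ := exists_ne τ
  exact B8Eq140Level.sideTouches_of_bondTouches hκ (Or.inl (Set.mem_univ y))

/-- **THEOREM 2 (p. 83) FOR `Ω_j = T_η` — THE EXISTENCE HALF OF `B8Thm2TorusAt.Thm2TorusAt … (unitaryUnits 𝔸) Reg` AT EVERY TORUS MEMBER, `β₀ = 0`,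
`P = Lᵏ·N`, MODULO THE FOUR KNIT SOCKETS AT TORUS MEMBERS** (see the module docstring, HONEST SCOPE (i)–(v)).
[cite: Balaban1985RegularSpaces, Thm 2 p.83, (1.33)–(1.39) pp.82–83, (1.29) p.81, p.77 («Ω_j = T_η for j = 0,1,…,l, l ≤ k»), Thm 4 p.88 («Of course this theorem implies Theorem 2»)] -/
theorem thm2TorusAt_exists_of_socketsE (hd2 : 2 ≤ d) {L : ℕ} (hL : 2 ≤ L) {β : ℝ} {len : LSite d → ℝ}
    {B₀ B₀' B₀β cu cF₀ cF cu' cB9 : ℝ} (hB₀ : 0 < B₀) (hB₀' : 0 < B₀') (hB₀β : 0 < B₀β) (hB : 2 ≤ 5 * (d : ℝ) * L * B₀)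
    (hcu : 0 < cu) (hcF₀ : 0 < cF₀) (hcF : 0 < cF) (hcu' : 0 < cu') (hcB9 : 0 < cB9)
    (SHFP₀ : ∀ t : TorusMember, SockHFP₀ (𝔸 := 𝔸) L B₀ B₀' cF₀ (torusIdx (d := d) (le_trans one_le_two hL) t).η
      (torusIdx (d := d) (le_trans one_le_two hL) t).k (torusIdx (d := d) (le_trans one_le_two hL) t).Ω
      (torusIdx (d := d) (le_trans one_le_two hL) t).Λs)
    (SHFP : ∀ t : TorusMember, SockHFP (𝔸 := 𝔸) L B₀ B₀' cF (torusIdx (d := d) (le_trans one_le_two hL) t).η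
      (torusIdx (d := d) (le_trans one_le_two hL) t).k (torusIdx (d := d) (le_trans one_le_two hL) t).Ω
      (torusIdx (d := d) (le_trans one_le_two hL) t).Λs)
    (SP5u : ∀ t : TorusMember, SockP5uE (𝔸 := 𝔸) L B₀ cu' cu (torusIdx (d := d) (le_trans one_le_two hL) t).η
      (torusIdx (d := d) (le_trans one_le_two hL) t).k (torusIdx (d := d) (le_trans one_le_two hL) t).Ω
      (torusIdx (d := d) (le_trans one_le_two hL) t).Λs)
    (SB9all : ∀ t : TorusMember, ∀ m, m ≤ (torusIdx (d := d) (le_trans one_le_two hL) t).k →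
      SockB9P3 (𝔸 := 𝔸) L B₀ B₀β cB9 β len (torusIdx (d := d) (le_trans one_le_two hL) t).η m
        (torusIdx (d := d) (le_trans one_le_two hL) t).Ω (torusIdx (d := d) (le_trans one_le_two hL) t).Λs
        (torusIdx (d := d) (le_trans one_le_two hL) t).Λb) :
    ∃ B₁ B₂ c₁ : ℝ, 0 < B₁ ∧ 0 < B₂ ∧ 0 < c₁ ∧
      ∀ t : TorusMember, ∀ N : ℤ, ∀ α₀ α₁ : ℝ, 0 < α₀ → 0 < α₁ → α₀ + α₁ ≤ c₁ →
        ∀ U₀ U' : LSite d → Fin d → 𝔸ˣ, (∀ x κ, U₀ x κ ∈ unitaryUnits 𝔸) → (∀ x κ, U' x κ ∈ unitaryUnits 𝔸) →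
          (∀ i : Fin d, shiftCfg ((((L : ℤ) ^ t.k * N)) • e i) U₀ = U₀) → (∀ i : Fin d, shiftCfg ((((L : ℤ) ^ t.k * N)) • e i) U' = U') →
          InAk L t.k t.η α₀ (fun _ => Set.univ) U₀ →
          InAk L t.k t.η α₀ (fun _ => Set.univ) (U' * U₀) → InAx L t.k (torusLam t.k) U₀ (U' * U₀) →
          Hyp135 L t.k (torusLam t.k) α₁ U₀ U' →
          ∃ u : LSite d → 𝔸ˣ, (∀ x, u x ∈ unitaryUnits 𝔸) ∧ (∀ (x : LSite d) (i : Fin d), u (x + (((L : ℤ) ^ t.k * N)) • e i) = u x) ∧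
            Restr129 L t.k (torusLam t.k) U₀ u ∧
            Concl2T L t.k ((L : ℤ) ^ t.k * N) t.η 0 B₁ B₂ len α₀ α₁ U₀ U' u := by
  have hL1 : 1 ≤ L := le_trans one_le_two hL
  have hd0 : 0 < (d : ℝ) := by exact_mod_cast lt_of_lt_of_le two_pos hd2
  obtain ⟨B₁, B₂, c₁, hB₁, hB₂, hc₁, H⟩ :=
    thm2_torus_periodic_of_socketsE (𝔸 := 𝔸) (β := β) (len := len) hd2 hL hB₀ hB₀' hB₀β hB hcu hcF₀ hcF hcu' hcB9 SHFP₀ SHFP SP5u SB9all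
  -- the interface's constants: `B₁(1 + 11d²)` absorbs the knit's smallness letter `α₀ + (11d²α₀ + α₁)`; `B₂ := 2·B₁(1 + 11d²)` (β₀ = 0)
  set D : ℝ := 1 + 11 * (d : ℝ) ^ 2 with hD
  have hD0 : 0 < D := by rw [hD]; positivity
  refine ⟨B₁ * D, 2 * (B₁ * D), c₁, mul_pos hB₁ hD0, by positivity, hc₁, ?_⟩
  intro t N α₀ α₁ hα₀ hα₁ hs U₀ U' hU₀ hU' hpU₀ hpU' h33 h34 hAx h135
  have hη := t.hη
  have h35 : Cond135T L t.k U₀ U' α₁ := (hyp135_torusLam_iff L t.k U₀ U' α₁).1 h135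
  obtain ⟨u, hR, hper, ⟨h136, h137, hLan, h139⟩, -⟩ :=
    H t α₀ α₁ hα₀ hα₁ hs ⟨U₀, hU₀⟩ (⟨U₀, hU₀⟩, ⟨U', hU'⟩) h33 trivial
      ⟨rfl, h34, inAx_torusLam_of_top hL1 hAx⟩ (h135_of_cond135T h35)
  -- concrete readings (the knit's fields unfold by `rfl`)
  set W : LSite d → Fin d → 𝔸ˣ := mgauge U₀ u.1⁻¹ U' with hW
  set s : ℝ := α₀ + (11 * (d : ℝ) ^ 2 * α₀ + α₁) with hs_def
  have hs0 : 0 < s := by rw [hs_def]; positivity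
  have hR' : Restr129 L t.k (torusLam t.k) U₀ u.1 := hR
  have hper' : ∀ w : LSite d, shiftCfg (((L : ℤ) ^ t.k) • w) U₀ = U₀ → shiftCfg (((L : ℤ) ^ t.k) • w) U' = U' →
      shiftCfg (((L : ℤ) ^ t.k) • w) u.1 = u.1 := hper
  have hLan' : IsLandau138 L t.k t.η (Set.univ : Set (LSite d)) (torusLam t.k) U₀ (logCfg t.η W) := hLan
  have h137' : ∀ j, j ≤ t.k → ∀ c ∈ torusLamb (d := d) t.k j,
      ‖logCovIter L U₀ (iEta t.η (mlogCfg t.k t.η (fun _ => (Set.univ : Set (LSite d))) W)) j c.1 c.2‖ < 2 * d * L * α₁ := h137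
  obtain ⟨h136a, h136g, -⟩ := h136
  obtain ⟨h139j, h139l⟩ := h139
  have h136a' : ∀ j, j ≤ t.k → ∀ b ∈ {b : LSite d × Fin d | SideTouches (Set.univ : Set (LSite d)) b.1 b.2},
      W b.1 b.2 = cfgExp t.η (logCfg t.η W) b.1 b.2 ∧ IsSelfAdjoint (logCfg t.η W b.1 b.2) ∧ ‖logCfg t.η W b.1 b.2‖ ≤ B₁ * s * ((L : ℝ) ^ j * t.η)⁻¹ := h136a
  have h136g' : msup L t.k t.η (-(2 : ℝ)) (fun _ (q : Fin d × Fin d × LSite d) => SideTouches (Set.univ : Set (LSite d)) q.2.2 q.2.1)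
      (fun q => covDerivFwd t.η U₀ q.1 (fun z => mlogCfg t.k t.η (fun _ => (Set.univ : Set (LSite d))) W z q.2.1) q.2.2) ≤ B₁ * s := h136g
  have h139j' : bondNorm L t.k t.η (-(3 : ℝ)) (fun _ => (Set.univ : Set (LSite d)))
      (fun x μ => pdiv t.η U₀ (plaqCovDeriv t.η U₀ (mlogCfg t.k t.η (fun _ => (Set.univ : Set (LSite d))) W)) μ x) ≤ B₁ * s := h139j
  have h139l' : bondNorm L t.k t.η (-(3 : ℝ)) (fun _ => (Set.univ : Set (LSite d)))
      (fun x μ => covLap t.η U₀ (fun z => mlogCfg t.k t.η (fun _ => (Set.univ : Set (LSite d))) W z μ) x) ≤ B₁ * s := h139l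
  rw [mlogCfg_univ hd2] at h137' h136g' h139j' h139l'
  set A : LSite d → Fin d → 𝔸 := logCfg t.η W with hA
  -- the period vector
  have hv : ∀ i : Fin d, (((L : ℤ) ^ t.k * N)) • e i = ((L : ℤ) ^ t.k) • (N • (e i : LSite d)) := fun i => by rw [mul_smul]
  have hpu : ∀ i : Fin d, shiftCfg ((((L : ℤ) ^ t.k * N)) • e i) u.1 = u.1 := by
    intro i
    rw [hv i]
    exact hper' (N • e i) (by rw [← hv i]; exact hpU₀ i) (by rw [← hv i]; exact hpU' i)
  have hpW : ∀ i : Fin d, shiftCfg ((((L : ℤ) ^ t.k * N)) • e i) W = W := by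
    intro i
    have h := mgauge_shiftCfg ((((L : ℤ) ^ t.k * N)) • e i) U₀ u.1⁻¹ U'
    have hinv : shiftCfg ((((L : ℤ) ^ t.k * N)) • e i) u.1⁻¹ = u.1⁻¹ := by
      funext x; have hx := congrFun (hpu i) x; simp only [shiftCfg_apply] at hx; simp only [shiftCfg_apply, Pi.inv_apply, hx]
    rw [hpU₀ i, hpU' i, hinv] at h
    exact h.symm
  -- pointwise data: the global bound, unitarity, smallness comparison
  have hU₀1 : ∀ y κ, U₀ y κ ∈ U1 𝔸 := fun y κ => unitaryUnits_le_U1 (hU₀ y κ)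
  have hA1 : ∀ j, j ≤ t.k → ∀ (x : LSite d) (μ : Fin d), ‖A x μ‖ ≤ B₁ * s * ((L : ℝ) ^ j * t.η)⁻¹ :=
    fun j hj x μ => (h136a' j hj (x, μ) (sideTouches_univ₄ hd2 x μ)).2.2
  have hA0 : ∀ (y : LSite d) (κ : Fin d), ‖A y κ‖ ≤ B₁ * s * t.η⁻¹ := by
    intro y κ; have h := hA1 0 (Nat.zero_le _) y κ; simpa using h
  have hcmp : B₁ * s < B₁ * D * (α₀ + α₁) := by
    have h1 : s < D * (α₀ + α₁) := by
      rw [hs_def, hD]; nlinarith [mul_pos (mul_pos (by norm_num : (0:ℝ) < 11) (pow_pos hd0 2)) hα₁]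
    nlinarith
  have hlt : ∀ (n : ℕ) (j : ℕ), B₁ * s * (((L : ℝ) ^ j * t.η)⁻¹) ^ n < B₁ * D * (α₀ + α₁) * (((L : ℝ) ^ j * t.η)⁻¹) ^ n :=
    fun n j => mul_lt_mul_of_pos_right hcmp (pow_pos (inv_pos.2 (scale_pos hL1 hη j)) n)
  -- (1.36)₂ pointwise
  have hgrad : ∀ j, j ≤ t.k → ∀ (x : LSite d) (μ κ : Fin d),
      ‖covDerivFwd t.η U₀ μ (fun z => A z κ) x‖ ≤ B₁ * s * (((L : ℝ) ^ j * t.η)⁻¹) ^ 2 := by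
    intro j hj x μ κ
    have hbdd : Bdd L t.k t.η (-((2 : ℕ) : ℝ)) (fun _ (q : Fin d × Fin d × LSite d) => SideTouches (Set.univ : Set (LSite d)) q.2.2 q.2.1)
        (fun q => covDerivFwd t.η U₀ q.1 (fun z => A z q.2.1) q.2.2) := by
      refine bdd_of_forall (c := ((L : ℝ) ^ t.k * t.η) ^ 2 * (t.η⁻¹ * (2 * (B₁ * s * t.η⁻¹)))) fun j' hj' q _ => ?_
      rw [weight_neg_natCast]
      have hq := norm_covDerivFwd_le_of_141 hη hU₀1 hA0 q.2.2 q.1 q.2.1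
      have hsc : ((L : ℝ) ^ j' * t.η) ^ 2 ≤ ((L : ℝ) ^ t.k * t.η) ^ 2 := by
        have hLr : (1 : ℝ) ≤ L := by exact_mod_cast hL1
        exact pow_le_pow_left₀ (scale_pos hL1 hη j').le (mul_le_mul_of_nonneg_right (pow_le_pow_right₀ hLr hj') hη.le) 2
      exact mul_le_mul hsc hq (norm_nonneg _) (by positivity)
    have hg' : msup L t.k t.η (-((2 : ℕ) : ℝ)) (fun _ (q : Fin d × Fin d × LSite d) => SideTouches (Set.univ : Set (LSite d)) q.2.2 q.2.1)
        (fun q => covDerivFwd t.η U₀ q.1 (fun z => A z q.2.1) q.2.2) ≤ B₁ * s := by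
      have e2 : (-((2 : ℕ) : ℝ)) = -(2 : ℝ) := by norm_num
      rw [e2]; exact h136g'
    exact le_of_weight_mul_le (F := fun q : Fin d × Fin d × LSite d => covDerivFwd t.η U₀ q.1 (fun z => A z q.2.1) q.2.2)
      hL1 hη 2 hbdd hg' hj (i := (μ, κ, x)) (sideTouches_univ₄ hd2 x κ)
  -- (1.39) pointwise
  have hG : ∀ (y : LSite d) (κ τ : Fin d), ‖covDerivFwd t.η U₀ κ (fun z => A z τ) y‖ ≤ t.η⁻¹ * (2 * (B₁ * s * t.η⁻¹)) :=
    fun y κ τ => norm_covDerivFwd_le_of_141 hη hU₀1 hA0 y κ τ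
  have hP : ∀ (ν κ : Fin d) (y : LSite d), ‖plaqCovDeriv t.η U₀ A ν κ y‖ ≤ 2 * (t.η⁻¹ * (2 * (B₁ * s * t.η⁻¹))) :=
    fun ν κ y => B8Ineq1141SectG.norm_plaqCovDeriv_le U₀ hG ν κ y
  have hsc3 : ∀ j', j' ≤ t.k → ((L : ℝ) ^ j' * t.η) ^ 3 ≤ ((L : ℝ) ^ t.k * t.η) ^ 3 := by
    intro j' hj'
    have hLr : (1 : ℝ) ≤ L := by exact_mod_cast hL1
    exact pow_le_pow_left₀ (scale_pos hL1 hη j').le (mul_le_mul_of_nonneg_right (pow_le_pow_right₀ hLr hj') hη.le) 3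
  have e3 : (-((3 : ℕ) : ℝ)) = -(3 : ℝ) := by norm_num
  have hJ : ∀ j, j ≤ t.k → ∀ (x : LSite d) (μ : Fin d),
      ‖pdiv t.η U₀ (plaqCovDeriv t.η U₀ A) μ x‖ ≤ B₁ * s * (((L : ℝ) ^ j * t.η)⁻¹) ^ 3 := by
    intro j hj x μ
    have hbdd : Bdd L t.k t.η (-((3 : ℕ) : ℝ)) (fun _ (b : LSite d × Fin d) => BondTouches (Set.univ : Set (LSite d)) b.1 b.2)
        (fun b => pdiv t.η U₀ (plaqCovDeriv t.η U₀ A) b.2 b.1) := by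
      refine bdd_of_forall (c := ((L : ℝ) ^ t.k * t.η) ^ 3 * (2 * d * (t.η⁻¹ * (2 * (t.η⁻¹ * (2 * (B₁ * s * t.η⁻¹))) +
          2 * (t.η⁻¹ * (2 * (B₁ * s * t.η⁻¹))))))) fun j' hj' b _ => ?_
      rw [weight_neg_natCast]
      exact mul_le_mul (hsc3 j' hj') (norm_pdiv_le_of_forall hη hU₀1 hP b.2 b.1) (norm_nonneg _) (by positivity)
    have hJ' : bondNorm L t.k t.η (-((3 : ℕ) : ℝ)) (fun _ => (Set.univ : Set (LSite d)))
        (fun x μ => pdiv t.η U₀ (plaqCovDeriv t.η U₀ A) μ x) ≤ B₁ * s := by rw [e3]; exact h139j'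
    exact le_of_weight_mul_le (F := fun b : LSite d × Fin d => pdiv t.η U₀ (plaqCovDeriv t.η U₀ A) b.2 b.1)
      hL1 hη 3 hbdd hJ' hj (i := (x, μ)) (Or.inl (Set.mem_univ x))
  have hLap : ∀ j, j ≤ t.k → ∀ (x : LSite d) (κ : Fin d),
      ‖covLap t.η U₀ (fun z => A z κ) x‖ ≤ B₁ * s * (((L : ℝ) ^ j * t.η)⁻¹) ^ 3 := by
    intro j hj x κ
    have hbdd : Bdd L t.k t.η (-((3 : ℕ) : ℝ)) (fun _ (b : LSite d × Fin d) => BondTouches (Set.univ : Set (LSite d)) b.1 b.2)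
        (fun b => covLap t.η U₀ (fun z => A z b.2) b.1) := by
      refine bdd_of_forall (c := ((L : ℝ) ^ t.k * t.η) ^ 3 *
          (d * (t.η⁻¹ * (t.η⁻¹ * (2 * (B₁ * s * t.η⁻¹)) + t.η⁻¹ * (2 * (B₁ * s * t.η⁻¹)))))) fun j' hj' b _ => ?_
      rw [weight_neg_natCast]
      exact mul_le_mul (hsc3 j' hj') (norm_covLap_le_of_forall hη hU₀1 (g := fun z => A z b.2) (fun y => hA0 y b.2) b.1)
        (norm_nonneg _) (by positivity)
    have hL' : bondNorm L t.k t.η (-((3 : ℕ) : ℝ)) (fun _ => (Set.univ : Set (LSite d)))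
        (fun x μ => covLap t.η U₀ (fun z => A z μ) x) ≤ B₁ * s := by rw [e3]; exact h139l'
    exact le_of_weight_mul_le (F := fun b : LSite d × Fin d => covLap t.η U₀ (fun z => A z b.2) b.1)
      hL1 hη 3 hbdd hL' hj (i := (x, κ)) (Or.inl (Set.mem_univ x))
  -- assembly
  refine ⟨u.1, u.2.1, fun x i => ?_, hR', A, ?_, ?_, ?_, ⟨?_, ?_, ?_⟩, ?_, hLan', ⟨?_, ?_⟩⟩
  · have h := congrFun (hpu i) x
    simpa only [shiftCfg_apply] using h
  · intro x μ
    exact (h136a' 0 (Nat.zero_le _) (x, μ) (sideTouches_univ₄ hd2 x μ)).2.1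
  · -- `A` is `P`-periodic
    intro x i μ
    have h := congrFun (congrFun (hpW i) x) μ
    simp only [shiftCfg_apply] at h
    show logCfg t.η W (x + (((L : ℤ) ^ t.k * N)) • e i) μ = logCfg t.η W x μ
    unfold logCfg
    rw [h]
  · funext x μ
    exact (h136a' 0 (Nat.zero_le _) (x, μ) (sideTouches_univ₄ hd2 x μ)).1
  · intro j hj x μ
    have h1 := hlt 1 j
    simp only [pow_one] at h1
    exact (hA1 j hj x μ).trans_lt h1
  · intro j hj x μ κ
    exact (hgrad j hj x μ κ).trans_lt (hlt 2 j)
  · -- (1.36)₃ at `β₀ = 0`: the oscillation of the gradient, transport unitary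
    intro β' hβ0 hβ1 j hj μ κ q _
    have hβ : β' = 0 := le_antisymm hβ1 hβ0
    subst hβ
    unfold hquot
    rw [Real.rpow_zero, div_one, add_zero, Real.rpow_two]
    have h1 := hgrad j hj q.2 μ κ
    have h2 := hgrad j hj q.1 μ κ
    have ht := norm_trans hU₀1 q.1 q.2 (covDerivFwd t.η U₀ μ (fun z => A z κ) q.2)
    calc ‖B9Eq340HolderZd.trans U₀ q.1 q.2 (covDerivFwd t.η U₀ μ (fun z => A z κ) q.2) - covDerivFwd t.η U₀ μ (fun z => A z κ) q.1‖
        ≤ ‖B9Eq340HolderZd.trans U₀ q.1 q.2 (covDerivFwd t.η U₀ μ (fun z => A z κ) q.2)‖ + ‖covDerivFwd t.η U₀ μ (fun z => A z κ) q.1‖ :=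
          norm_sub_le _ _
      _ ≤ B₁ * s * (((L : ℝ) ^ j * t.η)⁻¹) ^ 2 + B₁ * s * (((L : ℝ) ^ j * t.η)⁻¹) ^ 2 := by rw [ht]; exact add_le_add h1 h2
      _ < 2 * (B₁ * D) * (α₀ + α₁) * (((L : ℝ) ^ j * t.η)⁻¹) ^ 2 := by nlinarith [hlt 2 j]
  · intro x ν
    exact h137' t.k le_rfl (x, ν) ((mem_torusLamb_iff t.k t.k (x, ν)).2 rfl)
  · intro j hj x μ
    exact (hJ j hj x μ).trans_lt (hlt 3 j)
  · intro j hj x κ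
    exact (hLap j hj x κ).trans_lt (hlt 3 j)

end Supplier

#print axioms thm2TorusAt_exists_of_socketsE

end Literature.MathematicalPhysics.QuantumFieldTheory.Balaban1983to89.B8Thm2TorusAtSupplier

end
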